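import Mathlib

/-!
# Route BarrierLever — Chow witnesses for partition minors (item 20172, CPM): the DEGREE SUPPORT of a
# product of `n` affine forms — a layout without a degree-feasible transversal is missed by every
# product of `n` affine forms (the proved half of the slot conjecture (DEG))

Helper file (`--supports stmt-ValiantsHypothesis-20172`; cell valiant-natproofs, rung V4, 𝒟-side of
door (c); seat valiant-natproofs-prover gen 13).  Closes NO item; definition-free.

Conventions of items 19717 / 20172 / 20195: `E u w = Σ_{a∈u} e_{x_a} + Σ_{c∈w} e_{y_c}` has degree
`#u + #w`; the partition matrix of `f` at a layout `(u, w)` is `[coeff_{E (u i) (w j)} f]`.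

**The slot conjecture (DEG)** (memo HOME/prover/gen13/MEMO-slots-corners-g13.md §0.1; exact census:
`h = 2, 3` all layouts and all `n`, `h = 4` sampled): a product of `n ≤ 2h` GENERIC affine forms hits
the injective layout `(u, w)` iff there is a bijection `σ` with `#u_i + #w_{σ i} ≤ n` for every row
(Ferrers criterion; for `n` below the graded rank caps one more condition).  CPM is `n = 2h`, where the
condition is vacuous; conjecturally `2h − 1` forms suffice for every layout with `r ≥ 2`.
This file proves the «only if» half, for EVERY polynomial of total degree `≤ n` (so for every product of
`n` affine forms):

* `coeff_partitionExpo_eq_zero_of_totalDegree_lt` — `coeff (E u w) f = 0` when `f.totalDegree < #u + #w`;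
* `totalDegree_prod_affine_le` — a product of `n` forms of total degree `≤ 1` has total degree `≤ n`;
* `chow_det_eq_zero_of_no_degree_transversal` — **if no permutation `σ` has `#u_i + #w_{σ i} ≤ n` for all
  `i`, then `det[coeff_{E (u i) (w j)} f] = 0` for every `f` of total degree `≤ n`** (Leibniz: every
  permutation meets an entry above the degree support, which vanishes; cf. `det_mask_eq_zero_of_no_perm`
  of `…ChowMatchingGeneric` — this file is kept route-independent and imports only Mathlib);
  `chow_det_eq_zero_of_no_degree_transversal_prod` — the instance for products of `n` affine forms.

WHAT THIS IS NOT: the «if» half of (DEG) is OPEN (it contains item 20172); nothing on items 20172 /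
20195 / 19717 themselves, on crux stmt-ValiantsHypothesis-14610, or on `VP` versus `VNP`.
-/

set_option linter.dupNamespace false

namespace Summit.ValiantsHypothesis.ValiantsHypothesis.Theorems.BarrierLever.ChowFactor

open Finset MvPolynomial

noncomputable section

variable {h : ℕ}

/-! ## 1. Degree of the partition exponent and vanishing of high coefficients -/

/-- The degree (sum of exponents over the support) of `E u w` is `#u + #w`. -/
theorem sum_support_partitionExpo (u w : Finset (Fin h)) :
    (∑ v ∈ (∑ a ∈ u, Finsupp.single (Fin.castAdd h a) 1 +
        ∑ c ∈ w, Finsupp.single (Fin.natAdd h c) 1 : Fin (h + h) →₀ ℕ).support,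
      (∑ a ∈ u, Finsupp.single (Fin.castAdd h a) 1 +
        ∑ c ∈ w, Finsupp.single (Fin.natAdd h c) 1 : Fin (h + h) →₀ ℕ) v) = u.card + w.card := by
  rw [← Finsupp.degree_apply, map_add, map_sum, map_sum]
  simp [Finsupp.degree_single]

/-- **High partition exponents have zero coefficient**: `coeff (E u w) f = 0` if
`f.totalDegree < #u + #w`. -/
theorem coeff_partitionExpo_eq_zero_of_totalDegree_lt (f : MvPolynomial (Fin (h + h)) ℂ)
    (u w : Finset (Fin h)) (hf : f.totalDegree < u.card + w.card) :
    coeff (∑ a ∈ u, Finsupp.single (Fin.castAdd h a) 1 + ∑ c ∈ w, Finsupp.single (Fin.natAdd h c) 1)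
      f = 0 := by
  apply coeff_eq_zero_of_totalDegree_lt
  rw [sum_support_partitionExpo]
  exact hf

/-- A product of `n` polynomials of total degree `≤ 1` has total degree `≤ n`. -/
theorem totalDegree_prod_affine_le {σ : Type*} {n : ℕ} (ℓ : Fin n → MvPolynomial σ ℂ)
    (hℓ : ∀ k, (ℓ k).totalDegree ≤ 1) : (∏ k, ℓ k).totalDegree ≤ n := by
  refine (totalDegree_finsetProd _ _).trans ?_
  calc ∑ k, (ℓ k).totalDegree ≤ ∑ _k : Fin n, 1 := Finset.sum_le_sum fun k _ => hℓ k
    _ = n := by simp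

/-! ## 2. No degree-feasible transversal ⇒ every degree-`≤ n` polynomial misses the layout -/

/-- **The proved half of (DEG).**  If no permutation `σ` satisfies `#u_i + #w_{σ i} ≤ n` for every
`i`, then the partition minor of EVERY polynomial of total degree `≤ n` at the layout `(u, w)`
vanishes. -/
theorem chow_det_eq_zero_of_no_degree_transversal {r n : ℕ} (u w : Fin r → Finset (Fin h))
    (hno : ¬ ∃ σ : Equiv.Perm (Fin r), ∀ i, (u i).card + (w (σ i)).card ≤ n)
    (f : MvPolynomial (Fin (h + h)) ℂ) (hf : f.totalDegree ≤ n) :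
    (Matrix.of fun i j : Fin r => coeff
      (∑ a ∈ u i, Finsupp.single (Fin.castAdd h a) 1 + ∑ c ∈ w j, Finsupp.single (Fin.natAdd h c) 1)
      f).det = 0 := by
  classical
  rw [Matrix.det_apply]
  refine Finset.sum_eq_zero fun σ _ => ?_
  -- some entry of the transversal `i ↦ (σ i, i)` lies above the degree support
  have hσ : ∃ i, n < (u (σ i)).card + (w i).card := by
    by_contra hall
    push Not at hall
    exact hno ⟨σ.symm, fun i => by simpa using hall (σ.symm i)⟩
  obtain ⟨i₀, hi₀⟩ := hσ
  have hzero : (∏ i, (Matrix.of fun i j : Fin r => coeff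
      (∑ a ∈ u i, Finsupp.single (Fin.castAdd h a) 1 + ∑ c ∈ w j, Finsupp.single (Fin.natAdd h c) 1)
      f) (σ i) i) = 0 := by
    refine Finset.prod_eq_zero (Finset.mem_univ i₀) ?_
    rw [Matrix.of_apply]
    exact coeff_partitionExpo_eq_zero_of_totalDegree_lt f _ _ (lt_of_le_of_lt hf hi₀)
  rw [hzero, smul_zero]

/-- **Products of `n` affine forms** (the form the slot conjecture speaks about): without a
degree-feasible transversal, no product of `n` affine forms hits the layout. -/
theorem chow_det_eq_zero_of_no_degree_transversal_prod {r n : ℕ} (u w : Fin r → Finset (Fin h))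
    (hno : ¬ ∃ σ : Equiv.Perm (Fin r), ∀ i, (u i).card + (w (σ i)).card ≤ n)
    (ℓ : Fin n → MvPolynomial (Fin (h + h)) ℂ) (hℓ : ∀ k, (ℓ k).totalDegree ≤ 1) :
    (Matrix.of fun i j : Fin r => coeff
      (∑ a ∈ u i, Finsupp.single (Fin.castAdd h a) 1 + ∑ c ∈ w j, Finsupp.single (Fin.natAdd h c) 1)
      (∏ k, ℓ k)).det = 0 :=
  chow_det_eq_zero_of_no_degree_transversal u w hno _ (totalDegree_prod_affine_le ℓ hℓ)

end

end Summit.ValiantsHypothesis.ValiantsHypothesis.Theorems.BarrierLever.ChowFactor
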